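import Literature.NumberTheory.EllipticCurves.NeronModelOnePrime
import Literature.NumberTheory.EllipticCurves.NeronModelTwoOpens
import Literature.AlgebraicGeometry.Limits.LocalizationSchemeDescent
import Literature.AlgebraicGeometry.Limits.LocalizationSmoothSpread
import Literature.AlgebraicGeometry.Limits.LocalizationSeparatedSpread
import HarnessLib

/-!
# Néron models: the one-bad-prime gluing and the gluing leaf of Néron's theorem, proved

Last file of the gluing part of the existence programme for Néron models
(`Literature.NumberTheory.EllipticCurves.NeronModelExistence`). It **discharges** the named facts

* `exists_isNeronModel_of_away_of_atPrime_of_unique` (`NeronModelGluing`; Bosch–Lütkebohmert–Raynaud,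
  *Néron Models*, §1.4, the local-to-global passage at one closed point):
  `exists_isNeronModel_of_away_of_atPrime_of_unique_holds`;
* `exists_isNeronModel_of_away_of_atPrime` (`NeronModelExistence`; the local-to-global gluing
  leaf of Néron's theorem, BLR §1.4): `exists_isNeronModel_of_away_of_atPrime_holds`.

`NeronModelOnePrime` reduced the first to the statement `hD` that smooth separated quasi-compact
schemes over a model `R_𝔭` of the local ring extend to smooth separated quasi-compact schemes
over the models of some basic open neighbourhood `D(g) ∋ 𝔭`. This is the "limit argument" of
BLR's proof, and it is now available: schemes of finite presentation over the localization `R_𝔭`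
descend to `R` (`Literature.AlgebraicGeometry.Limits.LocApprox.exists_iso_pullback`, EGA IV₃
8.8.2 (ii) / Stacks 01ZM for `Spec R_𝔭 = lim_{g ∉ 𝔭} Spec R[1/g]`), and smoothness and
separatedness over `R_𝔭` spread to a neighbourhood (`LocApprox.exists_forall_smooth_snd`,
Stacks 0C0C / EGA IV₄ 17.7.8 (ii); `LocApprox.exists_forall_isSeparated_snd`, EGA IV₃ 8.10.5 (v)).
The second fact then follows from the first and the two-open-sets gluing
(`exists_isNeronModel_of_away_of_away_holds`, `NeronModelTwoOpens`) by the induction on the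
number of bad primes proved in `NeronModelGluing`
(`exists_isNeronModel_of_away_of_atPrime_of_unique_of_glue`).

## References

* S. Bosch, W. Lütkebohmert, M. Raynaud, *Néron Models*, Springer 1990, §1.2 (Prop. 4), §1.4
  (local Néron models over a dense open subscheme and at the finitely many remaining closed
  points glue to a global Néron model, by a limit argument). [BLRNeronModels1990] (Not held in
  the literature store, acq-00454; only the section is quoted, as in `NeronModelExistence`.)
* A. Grothendieck, EGA IV₃, Thm. 8.8.2 (ii), Prop. 8.10.5 (v); EGA IV₄, Prop. 17.7.8 (ii).
  [EGAIV3] [EGAIV4]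
* The Stacks project, Tags 01ZM, 0C0C. [StacksProject]
* J. H. Silverman, *Advanced Topics in the Arithmetic of Elliptic Curves*, GTM 151, 1994, proof of
  Thm. IV.6.1, p. 340 (the gluing sentence). [SilvermanATAEC1994]
-/

noncomputable section

universe u

namespace Literature.NumberTheory.EllipticCurves

open _root_.AlgebraicGeometry CategoryTheory Limits MonoidalCategory
open Literature.AlgebraicGeometry.Limits
open Literature.AlgebraicGeometry.Motives (SchemeOver specOver)
open scoped CategoryTheory.Obj

/-! ### Smooth separated quasi-compact schemes over `R_𝔭` extend over a neighbourhood of `𝔭` -/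

section LocalModels

variable {R : Type u} [CommRing R] (p : Ideal R) [p.IsPrime]

/-- **The "limit argument" of BLR §1.4.** A smooth separated quasi-compact scheme `X` over a model
`R_𝔭` of the local ring at a prime `𝔭` extends to a smooth separated quasi-compact scheme over
every model `R_g` of some basic open neighbourhood `D(g) ∋ 𝔭`, compatibly with base change to
`R_𝔭`: `X` descends to a scheme `P` of finite presentation over `R`
(`LocApprox.exists_iso_pullback`, EGA IV₃ 8.8.2 (ii)), `P` is smooth and separated over every
small enough `D(g)` (`LocApprox.exists_forall_smooth_snd`, `LocApprox.exists_forall_isSeparated_snd`),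
and `P ×_R R_g` is the required model (its base change to `R_𝔭` is `P ×_R R_𝔭 ≅ X`).
[cite: EGAIV3, Thm. 8.8.2 (ii) and Prop. 8.10.5 (v)] [cite: EGAIV4, Prop. 17.7.8 (ii)] -/
theorem exists_smooth_isSeparated_model_of_atPrime (Rp : Type u) [CommRing Rp] [Algebra R Rp]
    [IsLocalization.AtPrime Rp p] (X : Over (Spec (.of Rp))) (hsm : Smooth X.hom)
    (hsep : IsSeparated X.hom) (hqc : QuasiCompact X.hom) :
    ∃ g : R, g ∉ p ∧ ∀ (Rg : Type u) [CommRing Rg] [Algebra R Rg] [IsLocalization.Away g Rg]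
      [Algebra Rg Rp] [IsScalarTower R Rg Rp],
      ∃ Y : Over (Spec (.of Rg)), Smooth Y.hom ∧ IsSeparated Y.hom ∧ QuasiCompact Y.hom ∧
        Nonempty ((Over.pullback (specOfAlgebraMap Rg Rp)).obj Y ≅ X) := by
  haveI := hsm
  haveI := hsep
  haveI := hqc
  -- descend `X` to a scheme `P` of finite presentation over `R`
  obtain ⟨P, hPqc, hPqs, hPlfp, ⟨e⟩⟩ :=
    LocApprox.exists_iso_pullback (S := p.primeCompl) (B := Rp) X
  haveI := hPqc
  haveI := hPqs
  haveI := hPlfp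
  -- `P ×_R R_𝔭 ≅ X` is smooth and separated over `R_𝔭`
  have hsnd : pullback.snd P.hom (Spec.map (CommRingCat.ofHom (algebraMap R Rp))) =
      e.hom.left ≫ X.hom := (Over.w e.hom).symm
  haveI : IsIso e.hom.left := (Over.forget _).map_isIso e.hom
  have hsm' : Smooth (pullback.snd P.hom (Spec.map (CommRingCat.ofHom (algebraMap R Rp)))) := by
    rw [hsnd]
    exact (MorphismProperty.cancel_left_of_respectsIso @Smooth e.hom.left X.hom).mpr hsm
  have hsep' : IsSeparated (pullback.snd P.hom (Spec.map (CommRingCat.ofHom (algebraMap R Rp)))) := by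
    rw [hsnd]
    exact (MorphismProperty.cancel_left_of_respectsIso @IsSeparated e.hom.left X.hom).mpr hsep
  -- spread smoothness and separatedness to a neighbourhood `D(g)` of `𝔭`
  obtain ⟨s₁, hs₁, H₁⟩ := LocApprox.exists_forall_smooth_snd p.primeCompl Rp P hsm'
  obtain ⟨s₂, hs₂, H₂⟩ := LocApprox.exists_forall_isSeparated_snd p.primeCompl Rp P hsep'
  refine ⟨s₁ * s₂, (p.primeCompl.mul_mem hs₁ hs₂ : s₁ * s₂ ∈ p.primeCompl), ?_⟩
  intro Rg _ _ _ _ _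
  refine ⟨(Over.pullback (specOfAlgebraMap R Rg)).obj P, H₁ (s₁ * s₂) (dvd_mul_right s₁ s₂) Rg,
    H₂ (s₁ * s₂) (dvd_mul_left s₂ s₁) Rg, inferInstanceAs (QuasiCompact (pullback.snd _ _)), ⟨?_⟩⟩
  have hfac : specOfAlgebraMap Rg Rp ≫ specOfAlgebraMap R Rg = specOfAlgebraMap R Rp := by
    simp only [specOfAlgebraMap, ← Spec.map_comp, ← CommRingCat.ofHom_comp,
      ← IsScalarTower.algebraMap_eq R Rg Rp]
  exact pullbackObjIsoOfFac (specOfAlgebraMap R Rg) (specOfAlgebraMap Rg Rp) (specOfAlgebraMap R Rp)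
    hfac P ≪≫ e

end LocalModels

/-! ### The two named facts, discharged -/

section Discharge

/-- **The one-bad-prime gluing of Néron models holds** (Bosch–Lütkebohmert–Raynaud, *Néron
Models*, §1.4, the local-to-global passage at one closed point): if `𝔭` is the only maximal ideal of the Dedekind
domain `R` containing `f ≠ 0` and the `K`-group scheme `E` has Néron models over the models of
`R[1/f]` and of `R_𝔭`, then `E` has a Néron model over `R`. Assembly of
`exists_isNeronModel_of_away_of_atPrime_of_localModels` (`NeronModelOnePrime`) with the descent
of the local Néron model to a neighbourhood of `𝔭`
(`exists_smooth_isSeparated_model_of_atPrime`).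
[cite: BLRNeronModels1990, §1.4 (local-to-global passage, one closed point)] -/
theorem exists_isNeronModel_of_away_of_atPrime_of_unique_holds :
    exists_isNeronModel_of_away_of_atPrime_of_unique.{u} := by
  intro R _ _ K _ _ _ E _ f p _ hf hfp huniq HA HP
  exact exists_isNeronModel_of_away_of_atPrime_of_localModels E f hf p hfp huniq HA HP
    fun Rp _ _ _ X hsm hsep hqc => exists_smooth_isSeparated_model_of_atPrime p Rp X hsm hsep hqc

/-- **The gluing leaf of Néron's existence theorem holds** (Bosch–Lütkebohmert–Raynaud, *Néron
Models*, §1.4; Artin, *Néron Models*, proof of Thm. (1.2), p. 228: "Clearly, we may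
assume `R` local"; Silverman, *ATAEC*, proof of Thm. IV.6.1, p. 340): a group scheme over the
fraction field `K` of a Dedekind domain `R` with Néron models over the models of `R[1/f]`
(`f ≠ 0`) and over the models of `R_𝔭` for every maximal `𝔭 ∋ f` has a Néron model over `R`.
Proved by the induction on the number of bad primes of `NeronModelGluing`
(`exists_isNeronModel_of_away_of_atPrime_of_unique_of_glue`) from the one-bad-prime case
(`exists_isNeronModel_of_away_of_atPrime_of_unique_holds`) and the two-open-sets gluing
(`exists_isNeronModel_of_away_of_away_holds`, `NeronModelTwoOpens`).
[cite: BLRNeronModels1990, §1.4 (global case: gluing local Néron models over a Dedekind scheme)]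
[cite: Artin1986NeronModels, proof of Thm. (1.2) (p. 228, reduction to the local case)] -/
theorem exists_isNeronModel_of_away_of_atPrime_holds : exists_isNeronModel_of_away_of_atPrime.{u} :=
  exists_isNeronModel_of_away_of_atPrime_of_unique_of_glue
    exists_isNeronModel_of_away_of_atPrime_of_unique_holds exists_isNeronModel_of_away_of_away_holds

end Discharge

end Literature.NumberTheory.EllipticCurves

end
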